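import Summits.BirchSwinnertonDyer.Rank1Residual.Additive.CyclotomicTowerSignedSelmerEtaSummand
import Summits.BirchSwinnertonDyer.Rank1Residual.Iwasawa.NoFiniteSubmoduleQuotientRank
import HarnessLib

/-!
# Kitajima–Otsuki 2018 §4.2 ON THE TREE'S OBJECTS: the classical dual `X(E/K_∞)` over Kobayashi's
# tower, the `Λ`-linear restriction `X(E/K_∞) ↠ X^ε(E/K_∞)` dual to `Sel^ε ⊆ Sel`, and Thm. 4.8
# (`X^ε` has no finite `Λ`-submodule) REDUCED IN THE KERNEL to Thm. 4.5 (the classical dual has none),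
# [Gre99] Thm. 1.7 (`rank_Λ X ≥ r`) and Prop. 3.32 (the annihilator of `Sel^ε` is the image of `Λ^r`)
# (cell `bsd-potss`, seat `bsd-potss-k8q-c5` g2; K8-Gss2 node (R2±) `NoFiniteSubmoduleSigned`, items
# stmt-BirchSwinnertonDyer-19117 / 19222 / 19233, binder 19301 `PublishedInputKO13`)

HONEST FRAMING (cell `bsd-potss`, run/shared/lean/pub/bsd-potss/; FULL-BSD rank ≤ 1 programme,
tranche 1b): INFRASTRUCTURE — ONE transparent definition (`towerSelmerInfty`, the classical
`Sel_{p^∞}(E/K₀·K_∞^κ)` `Γ_K`-internally = `selmerGroupOver` of `towerTopSubgroup`), ONE hypothesis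
structure (`TowerSelmerDualData`, field for field the tree's `WeierstrassCurve.SelmerDualData` /
`TowerSignedSelmerDualData` with `Sel^ε(E/K_∞) ↦ Sel(E/K_∞)`), the restricted conjugation
`conjTowerSelmerInfty`, ONE construction (`towerSelmerDualData`, existence) and THEOREMS; no named
Literature fact, no `Prop` definition, no `sorry`, axioms standard. NOTHING of Kitajima–Otsuki's
Thm. 1.3 / 4.5 / Prop. 3.32, of Greenberg's Thm. 1.7 or of Kobayashi's Thm. 2.2 is asserted: where they
enter (§4–§5) they are DISPLAYED hypotheses. The K8 items stay exactly as open as before (settled by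
citation through the binder `PublishedInputKO13`); this file proves the §4.2 layer of the binder's printed
proof on the tree's own objects, so that what remains of it BY NAME is Thm. 4.5 (§4.1: Matsuno 2003),
[Gre99] Thm. 1.7 and Prop. 3.32 (§3). Nothing is booked; no label / mark / count moves. BSD is not
proved by any of this.

## Source, verbatim (Kitajima–Otsuki, arXiv:1607.03612 = Tokyo J. Math. 41 (2018), §4.2 p. 19)

"Let us consider the following exact sequence of `Λ`-modules coming from the definition of the Selmer
groups; `⊕_{v ∈ S^ss} (H¹(F_{∞,v},E[p^∞]) / E^±(F_{∞,v}) ⊗ ℚ_p/ℤ_p)^∨ →^{ι^±} Sel(F_∞,E[p^∞])^∨ →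
Sel^±(F_∞,E[p^∞])^∨ → 0`. (4.2)" "Proposition 4.6. Assume that `Sel^±(F_∞, E[p^∞])^∨` is `Λ`-torsion.
If each direct summand … is a torsion-free `Λ`-module of `Λ`-rank `[F_{0,v}:ℚ_p]`, then the map `ι^±` …
is injective. Proof. We have `rank_Λ (Sel(F_∞, E[p^∞])^∨) ≥ Σ_v [F_{0,v}:ℚ_p]` (cf. [Gre99] Theorem
1.7) …" "Proposition 4.7 (Greenberg [Gre99] p.104–105). Let `f : M → N` be an injective homomorphism
of `Λ`-modules. Suppose that `N` is a finitely generated `Λ`-module which has no nontrivial finite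
`Λ`-submodule, and that `M` is a free `Λ`-module. Then the cokernel `Coker(f)` has no nontrivial finite
`Λ`-submodule." "Theorem 4.8. … Proof. By Proposition 3.32, we have `(H¹(F_{∞,v},E[p^∞]) /
E^±(F_{∞,v}) ⊗ ℚ_p/ℤ_p)^∨ ≅ Λ^{⊕[F_{0,v}:ℚ_p]}` … Thus we can apply Proposition 4.6 and Proposition 4.7
for `f = ι^±`. Thus, by Theorem 4.5, we get the desired result."

## Contents (data: `K`, `κ : ZpExtension K p`, `K₀/K` with `Gal(K̄/K₀)` normal, `E` a model of the
## completion above `p`, a sign `ε`; `K_∞ = K₀·K_∞^κ`, `Γ_K`-internally `towerTopSubgroup κ K₀`)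

* §1 `towerSelmerInfty W κ K₀ := W.selmerGroupOver p (towerTopSubgroup κ K₀)` — the classical
  `Sel_{p^∞}(E/K_∞)` in which Def. 2.1 cuts out `Sel^ε`; `towerSignedSelmerInfty_le_towerSelmerInfty`
  (`Sel^ε(E/K_∞) ≤ Sel(E/K_∞)`: each layer `Sel^ε(E/K_n) ≤ Sel(E/K_n)` restricts into `Sel(E/K_∞)`).
* §2 `TowerSelmerDualData W κ K₀ γ` — `X(E/K_∞) = Hom(Sel(E/K_∞), ℚ/ℤ)` as a `Λ = ℤ_p⟦T⟧`-module,
  `T ↔ conj_γ − 1`; `conjTowerSelmerInfty`, `isLocNil_conjTowerSelmerInfty_sub_one` ((P)+(A2) of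
  cc-typer-6's FILE 3, for EVERY class of `H¹(K_∞, E[p^∞])`); EXISTENCE `towerSelmerDualData`.
* §3 **`TowerSelmerDualData.exists_restrict`** — the `Λ`-LINEAR SURJECTION `π : X(E/K_∞) ↠ X^ε(E/K_∞)`
  dual to the inclusion `Sel^ε ⊆ Sel` (x2's `X2.DualRestriction.exists_restrict_surjective`), with
  `π x = 0 ↔ x` annihilates `Sel^ε` — the right half of (4.2), `Γ_K`-internally.
* §4 **`TowerSignedSelmerDualData.forall_finite_eq_bot_of_towerSelmerDual`** — THM. 4.8 ON THE OBJECTS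
  (`K : Type`): if `X(E/K_∞)` has no non-zero finite `Λ`-submodule [Thm. 4.5], `rank_Λ X(E/K_∞) ≥ r`
  [Gre99 Thm. 1.7], the annihilator of `Sel^ε` in `X(E/K_∞)` is the image of a `Λ`-linear `Λ^r → X`
  [Prop. 3.32 + the left half of (4.2)], and `X^ε` is torsion [(vi)], then `X^ε(E/K_∞)` has no non-zero
  finite `Λ`-submodule — Prop. 4.6 + 4.7 being the tree's rank-`r` algebra
  `Iwasawa.forall_finite_eq_bot_of_surjective_of_ker_eq_range_of_le_rank`.
* (sequel, `Theorems/QuadraticBranchSignedControlNoFiniteSubmoduleOfMainThmI.lean`) the K8 binder's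
  printed-shape fact `KitajimaOtsuki2018.mainThm13_towerSignedSelmerDual_noFiniteSubmodule` and the node
  `NoFiniteSubmoduleSigned` from (I) Thm. 4.5 for `F = ℚ` + (L) [Gre99] Thm. 1.7 ∧ Prop. 3.32
  (`r = [ℚ_p(μ_p) : ℚ_p] = p − 1`) via §4.

References: [KitajimaOtsuki2018] §4.2: (4.2), Prop. 4.6, Prop. 4.7, Thm. 4.8; Thm. 4.5; Prop. 3.32;
Remark 1.4 (5) (arXiv:1607.03612 pp. 4, 17–19); [GreenbergLNM1716] §1 p. 60 (the dual as a
`Λ`-module), Thm. 1.7, pp. 104–105; [Kobayashi2003] Def. 2.1, Thm. 2.2 (p. 5), §3 p. 5 (`γ ↔ 1 + X`).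
-/

set_option autoImplicit false

noncomputable section

open scoped Classical

universe u

namespace Summit.BirchSwinnertonDyer.Rank1Residual.Additive

open Literature.NumberTheory.EllipticCurves Literature.NumberTheory.GaloisRepresentations
  Literature.NumberTheory.EllipticCurves.IwasawaAlgebra Literature.NumberTheory.EllipticCurves.IwasawaDual
  ZpExtension

/-! ## §1 The classical Selmer group `Sel(E/K_∞)` over the tower and `Sel^ε(E/K_∞) ≤ Sel(E/K_∞)` -/

section Selmer

variable {K : Type u} [Field K] [NumberField K] (W : WeierstrassCurve K) {p : ℕ} [Fact p.Prime]
  (κ : ZpExtension K p) (K₀ : Type u) [Field K₀] [Algebra K K₀] [(galRange (K := K) K₀).Normal]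

/-- **The classical `Sel_{p^∞}(E/K_∞)`, `K_∞ = K₀·K_∞^κ`, `Γ_K`-internally**: the tree's
`selmerGroupOver` of the normal subgroup `towerTopSubgroup κ K₀ = ker κ ⊓ Gal(K̄/K₀)` (classical local
conditions at every place, imposed at every `Γ_K`-conjugate). For `K = ℚ`, `κ` cyclotomic,
`K₀ = ℚ(μ_p)`: Kitajima–Otsuki's `Sel(F_∞, E[p^∞])`, `F_∞ = ℚ(μ_{p^∞})`, the middle term of (4.2).
[cite: KitajimaOtsuki2018, Def. 2.1 (2) and (4.2) (arXiv:1607.03612 pp. 6, 19)]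
[cite: GreenbergLNM1716, §1 (p. 60)] -/
def towerSelmerInfty : AddSubgroup (W.subgroupH1 p (towerTopSubgroup κ K₀)) :=
  W.selmerGroupOver p (towerTopSubgroup κ K₀)

/-- Unfolding `towerSelmerInfty` (definitional). [cite: KitajimaOtsuki2018, Def. 2.1 (2)] -/
theorem towerSelmerInfty_def :
    towerSelmerInfty W κ K₀ = W.selmerGroupOver p (towerTopSubgroup κ K₀) := rfl

/-- `Sel(E/K_∞)` is stable under the conjugation action of `Γ_K` (`map_conjH1_selmerGroupOver_le`).
[cite: GreenbergLNM1716, §1 (p. 60: Sel_E(F_∞)_p is invariant under the action of Γ)] -/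
theorem conjH1_mem_towerSelmerInfty (γ : Field.absoluteGaloisGroup K)
    {s : W.subgroupH1 p (towerTopSubgroup κ K₀)} (hs : s ∈ towerSelmerInfty W κ K₀) :
    W.conjH1 p (towerTopSubgroup κ K₀) γ s ∈ towerSelmerInfty W κ K₀ :=
  W.map_conjH1_selmerGroupOver_le_holds p (towerTopSubgroup κ K₀) γ ⟨s, hs, rfl⟩

variable [NumberField K₀] (E : Type u) [Field E] [Algebra K E]

/-- **`Sel^ε(E/K_∞) ≤ Sel(E/K_∞)`**: every layer `Sel^ε(E/K_n) ≤ Sel(E/K_n)`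
(`towerSignedSelmerLayer_le_selmerGroupOver`) restricts into `Sel(E/K_∞)`
(`resOfLe_mem_selmerGroupOver`), so the union of the images does. The inclusion whose Pontryagin dual
is the surjection `Sel(F_∞)^∨ → Sel^±(F_∞)^∨` of (4.2). [cite: KitajimaOtsuki2018, Def. 2.1 (2) and (4.2)]
[cite: Kobayashi2003, Def. 2.1 (p. 5)] -/
theorem towerSignedSelmerInfty_le_towerSelmerInfty (ε : ℤˣ) :
    towerSignedSelmerInfty W κ K₀ E ε ≤ towerSelmerInfty W κ K₀ := by
  refine iSup_le fun n ↦ ?_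
  rintro _ ⟨c, hc, rfl⟩
  exact W.resOfLe_mem_selmerGroupOver p (towerTopSubgroup_le κ K₀ n)
    (towerSignedSelmerLayer_le_selmerGroupOver W κ K₀ E ε n hc)

/-- The inclusion `Sel^ε(E/K_∞) ↪ Sel(E/K_∞)` as an additive map. [cite: KitajimaOtsuki2018, (4.2)] -/
def towerSignedToSelmerInfty (ε : ℤˣ) : towerSignedSelmerInfty W κ K₀ E ε →+ towerSelmerInfty W κ K₀ :=
  AddSubgroup.inclusion (towerSignedSelmerInfty_le_towerSelmerInfty W κ K₀ E ε)

/-- The inclusion on underlying classes (definitional). [cite: KitajimaOtsuki2018, (4.2)] -/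
@[simp]
theorem coe_towerSignedToSelmerInfty_apply (ε : ℤˣ) (t : towerSignedSelmerInfty W κ K₀ E ε) :
    ((towerSignedToSelmerInfty W κ K₀ E ε t : towerSelmerInfty W κ K₀) :
        W.subgroupH1 p (towerTopSubgroup κ K₀)) = t :=
  rfl

/-- The inclusion is injective. [cite: KitajimaOtsuki2018, (4.2)] -/
theorem towerSignedToSelmerInfty_injective (ε : ℤˣ) :
    Function.Injective (towerSignedToSelmerInfty W κ K₀ E ε) :=
  AddSubgroup.inclusion_injective _

end Selmer

/-! ## §2 The classical dual `X(E/K_∞)` as a hypothesis structure, and its existence -/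

section Dual

variable {K : Type u} [Field K] [NumberField K] {p : ℕ} [Fact p.Prime]

/-- **Pontryagin-dual data for the classical `Sel(E/K_∞)`** (`K_∞ = K₀·K_∞^κ`) — field for field the
tree's `WeierstrassCurve.SelmerDualData` (`ker κ ↦ towerTopSubgroup κ K₀`) and cc-typer-6's /
bsd-potss's signed tower data (`Sel^ε ↦ Sel`): the Iwasawa module `X(E/K_∞) = Hom(Sel(E/K_∞), ℚ/ℤ)` as
an abstract `Λ = ℤ_p⟦T⟧`-module `X` (`T ↔ conj_γ − 1` for `γ ∈ Gal(K̄/K₀)` with `κ γ` a generator —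
Kitajima–Otsuki §4: `Λ = ℤ_p[[Gal(F_∞/F_0)]]`, "we fix a topological generator `γ ∈ Γ` … identifying `γ`
with `1 + X`"), with `conj_mem`, `toDual` bijective, the `T`-axiom and the constants axiom. For `K = ℚ`,
`κ` cyclotomic, `K₀ = ℚ(μ_p)`: the object `Sel(F_∞, E[p^∞])^∨` of Thm. 4.5 and of (4.2). NOTHING about
finite generation, torsion, rank or finite submodules is asserted.
[cite: KitajimaOtsuki2018, §4 p. 18 (Λ, γ ↔ 1 + X), Thm. 4.5 and (4.2) (the object only)]
[cite: GreenbergLNM1716, §1 (p. 60)] -/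
structure TowerSelmerDualData (W : WeierstrassCurve K) (κ : ZpExtension K p)
    (K₀ : Type u) [Field K₀] [Algebra K K₀] [(galRange (K := K) K₀).Normal]
    (γ : Field.absoluteGaloisGroup K) where
  /-- The underlying type of the Iwasawa module `X(E/K_∞)`. -/
  X : Type u
  /-- `X` is an abelian group. -/
  [addCommGroup : AddCommGroup X]
  /-- `X` is a `Λ = ℤ_p⟦T⟧`-module. -/
  [module : Module (IwasawaAlgebra p) X]
  /-- `Sel(E/K_∞)` is stable under conjugation by `γ` (holds by `conjH1_mem_towerSelmerInfty`). -/
  conj_mem : ∀ s ∈ towerSelmerInfty W κ K₀,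
    W.conjH1 p (towerTopSubgroup κ K₀) γ s ∈ towerSelmerInfty W κ K₀
  /-- The identification of `X` with the character group `Hom(Sel_∞, ℚ/ℤ)`. -/
  toDual : X →+ (towerSelmerInfty W κ K₀ →+ AddCircle (1 : ℚ))
  /-- `toDual` is a group isomorphism. -/
  bijective : Function.Bijective toDual
  /-- `T` acts as `γ - 1`: `(T·x)(s) = x(conj_γ s) - x(s)`. -/
  toDual_T_smul : ∀ (x : X) (s : towerSelmerInfty W κ K₀),
    toDual ((PowerSeries.X : IwasawaAlgebra p) • x) s =
      toDual x ⟨W.conjH1 p (towerTopSubgroup κ K₀) γ s, conj_mem s s.2⟩ - toDual x s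
  /-- Constants `c ∈ ℤ_p` act on `pᵏ`-torsion classes through `ℤ_p → ℤ/pᵏ`. -/
  toDual_C_smul : ∀ (c : ℤ_[p]) (x : X) (s : towerSelmerInfty W κ K₀) (k : ℕ),
    (p ^ k) • s = 0 → toDual (PowerSeries.C c • x) s = (PadicInt.toZModPow k c).val • toDual x s

/-- The dual of a datum is an abelian group (instance on the NEW type `D.X`, exactly as the tree's
`TowerSignedSelmerDualData.instAddCommGroupX`; no library instance is touched).
[cite: GreenbergLNM1716, §1 (p. 60) (the object only)] -/
instance TowerSelmerDualData.instAddCommGroupX {W : WeierstrassCurve K} {κ : ZpExtension K p}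
    {K₀ : Type u} [Field K₀] [Algebra K K₀] [(galRange (K := K) K₀).Normal]
    {γ : Field.absoluteGaloisGroup K} (D : TowerSelmerDualData W κ K₀ γ) : AddCommGroup D.X :=
  D.addCommGroup

/-- The dual of a datum is a `Λ`-module (instance on the NEW type `D.X`).
[cite: GreenbergLNM1716, §1 (p. 60) (the object only)] -/
instance TowerSelmerDualData.instModuleX {W : WeierstrassCurve K} {κ : ZpExtension K p}
    {K₀ : Type u} [Field K₀] [Algebra K K₀] [(galRange (K := K) K₀).Normal]
    {γ : Field.absoluteGaloisGroup K} (D : TowerSelmerDualData W κ K₀ γ) :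
    Module (IwasawaAlgebra p) D.X :=
  D.module

variable (W : WeierstrassCurve K) (κ : ZpExtension K p) (K₀ : Type u) [Field K₀] [Algebra K K₀]
  [(galRange (K := K) K₀).Normal]

/-- `conj_γ` restricted to an endomorphism of `Sel(E/K_∞)` (`conjH1_mem_towerSelmerInfty`) — the action
through which `Λ = ℤ_p[[Γ]]` acts on `X(E/K_∞)`. [cite: GreenbergLNM1716, §1 (p. 60)] -/
def conjTowerSelmerInfty (γ : Field.absoluteGaloisGroup K) : AddMonoid.End (towerSelmerInfty W κ K₀) :=
  ((W.conjH1 p (towerTopSubgroup κ K₀) γ).restrict (towerSelmerInfty W κ K₀)).codRestrict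
    (towerSelmerInfty W κ K₀) fun s ↦ conjH1_mem_towerSelmerInfty W κ K₀ γ s.2

/-- Unfolding `conjTowerSelmerInfty` (definitional). [cite: GreenbergLNM1716, §1 (p. 60)] -/
@[simp]
theorem coe_conjTowerSelmerInfty_apply (γ : Field.absoluteGaloisGroup K) (s : towerSelmerInfty W κ K₀) :
    ((conjTowerSelmerInfty W κ K₀ γ s : towerSelmerInfty W κ K₀) :
        W.subgroupH1 p (towerTopSubgroup κ K₀)) = W.conjH1 p (towerTopSubgroup κ K₀) γ s :=
  rfl

/-- Powers of the restriction are restrictions of `conj_{γ^m}`. [cite: GreenbergLNM1716, §1 (p. 60)] -/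
theorem coe_conjTowerSelmerInfty_pow_apply (γ : Field.absoluteGaloisGroup K) (m : ℕ)
    (s : towerSelmerInfty W κ K₀) :
    ((((conjTowerSelmerInfty W κ K₀ γ) ^ m) s : towerSelmerInfty W κ K₀) :
        W.subgroupH1 p (towerTopSubgroup κ K₀)) = W.conjH1 p (towerTopSubgroup κ K₀) (γ ^ m) s := by
  induction m generalizing s with
  | zero => rw [pow_zero, pow_zero, AddMonoid.End.one_apply,
      W.conjH1_one_holds p (towerTopSubgroup κ K₀), AddMonoidHom.id_apply]
  | succ m ih =>
    rw [pow_succ, AddMonoid.End.coe_mul, Function.comp_apply, ih,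
      coe_conjTowerSelmerInfty_apply, pow_succ, W.conjH1_mul_holds p (towerTopSubgroup κ K₀),
      AddMonoidHom.comp_apply]

variable [NumberField K₀]

/-- **`Sel(E/K_∞)` is `p`-primary and `T = conj_γ − 1` is locally nilpotent on it** for
`γ ∈ Gal(K̄/K₀)` with `κ γ = 1` and `κ` onto on `Gal(K̄/K₀)` — (P) and (A2) of cc-typer-6's FILE 3
(`exists_pow_smul_subgroupH1_towerTop_eq_zero`, `exists_conjH1_pow_prime_pow_towerTop_eq`, valid for
EVERY class of `H¹(K_∞, E[p^∞])`), word for word bsd-potss's `isLocNil_conjTowerSignedSelmerInfty_sub_one`.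
[cite: GreenbergLNM1716, §1 (p. 60: "every element of which is killed by Tⁿ for some n")] -/
theorem isLocNil_conjTowerSelmerInfty_sub_one
    (hK₀ : ∀ x : Multiplicative ℤ_[p], ∃ g ∈ galRange (K := K) K₀, κ g = x)
    {γ : Field.absoluteGaloisGroup K} (hγ : κ.IsTopGenerator γ) (hγ₀ : γ ∈ galRange (K := K) K₀) :
    IwasawaDual.IsLocNil p (conjTowerSelmerInfty W κ K₀ γ - 1) := by
  have htor : ∀ s : towerSelmerInfty W κ K₀, ∃ k : ℕ, p ^ k • s = 0 := fun s ↦ by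
    obtain ⟨k, hk⟩ := exists_pow_smul_subgroupH1_towerTop_eq_zero W κ K₀
      (s : W.subgroupH1 p (towerTopSubgroup κ K₀))
    exact ⟨k, Subtype.ext (by rw [AddSubgroupClass.coe_nsmul]; exact hk)⟩
  refine ⟨htor, fun s ↦ ?_⟩
  obtain ⟨a, ha⟩ := exists_conjH1_pow_prime_pow_towerTop_eq W κ K₀ hK₀ hγ hγ₀
    (s : W.subgroupH1 p (towerTopSubgroup κ K₀))
  obtain ⟨k, hk⟩ := htor s
  have hφ : ((conjTowerSelmerInfty W κ K₀ γ) ^ p ^ a) s = s :=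
    Subtype.ext (by rw [coe_conjTowerSelmerInfty_pow_apply]; exact ha)
  exact ⟨k * p ^ a, IwasawaDual.pow_mul_prime_pow_apply_eq_zero (Fact.out : p.Prime) _ a hφ hk⟩

/-- **EXISTENCE of the classical tower datum**: `X(E/K_∞) = Hom(Sel(E/K_∞), ℚ/ℤ)` with the `Λ`-structure
`IsLocNil.module` (`T = γ − 1`) IS a `TowerSelmerDualData W κ K₀ γ` — word for word bsd-potss's
`towerSignedSelmerDualData`. So every statement "`∀ Dc : TowerSelmerDualData …`" is NON-VACUOUS under
(A2)'s hypotheses. [cite: GreenbergLNM1716, §1 (p. 60)] -/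
def towerSelmerDualData
    (hK₀ : ∀ x : Multiplicative ℤ_[p], ∃ g ∈ galRange (K := K) K₀, κ g = x)
    {γ : Field.absoluteGaloisGroup K} (hγ : κ.IsTopGenerator γ) (hγ₀ : γ ∈ galRange (K := K) K₀) :
    TowerSelmerDualData W κ K₀ γ :=
  { X := towerSelmerInfty W κ K₀ →+ AddCircle (1 : ℚ)
    module := (isLocNil_conjTowerSelmerInfty_sub_one W κ K₀ hK₀ hγ hγ₀).module
    conj_mem := fun s hs ↦ conjH1_mem_towerSelmerInfty W κ K₀ γ hs
    toDual := AddMonoidHom.id _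
    bijective := Function.bijective_id
    toDual_T_smul := fun x s ↦ by
      show (isLocNil_conjTowerSelmerInfty_sub_one W κ K₀ hK₀ hγ hγ₀).smulFun
          PowerSeries.X x s = x _ - x s
      rw [(isLocNil_conjTowerSelmerInfty_sub_one W κ K₀ hK₀ hγ hγ₀).smulFun_X_apply,
        IwasawaDual.End_sub_apply, AddMonoid.End.one_apply, map_sub]
      rfl
    toDual_C_smul := fun c x s k hk ↦ by
      show (isLocNil_conjTowerSelmerInfty_sub_one W κ K₀ hK₀ hγ hγ₀).smulFun
          (PowerSeries.C c) x s = _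
      exact (isLocNil_conjTowerSelmerInfty_sub_one W κ K₀ hK₀ hγ hγ₀).smulFun_C_apply c x hk }

/-- Non-vacuity: `TowerSelmerDualData W κ K₀ γ` is inhabited for `γ ∈ Gal(K̄/K₀)` a topological
generator and `κ` onto on `Gal(K̄/K₀)`. [cite: GreenbergLNM1716, §1 (p. 60)] -/
theorem nonempty_towerSelmerDualData
    (hK₀ : ∀ x : Multiplicative ℤ_[p], ∃ g ∈ galRange (K := K) K₀, κ g = x)
    {γ : Field.absoluteGaloisGroup K} (hγ : κ.IsTopGenerator γ) (hγ₀ : γ ∈ galRange (K := K) K₀) :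
    Nonempty (TowerSelmerDualData W κ K₀ γ) :=
  ⟨towerSelmerDualData W κ K₀ hK₀ hγ hγ₀⟩

end Dual

/-! ## §3 The `Λ`-linear restriction `X(E/K_∞) ↠ X^ε(E/K_∞)` dual to `Sel^ε ⊆ Sel` -/

section Restrict

variable {K : Type u} [Field K] [NumberField K] (W : WeierstrassCurve K) {p : ℕ} [Fact p.Prime]
  (κ : ZpExtension K p) (K₀ : Type u) [Field K₀] [NumberField K₀] [Algebra K K₀]
  [(galRange (K := K) K₀).Normal] (E : Type u) [Field E] [Algebra K E] (ε : ℤˣ)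

/-- The inclusion `Sel^ε ↪ Sel` intertwines the two restricted conjugations `conj_γ`.
[cite: KitajimaOtsuki2018, (4.2) (a sequence of Λ-modules)] -/
theorem conjTowerSelmerInfty_towerSignedToSelmerInfty (γ : Field.absoluteGaloisGroup K)
    (t : towerSignedSelmerInfty W κ K₀ E ε) :
    conjTowerSelmerInfty W κ K₀ γ (towerSignedToSelmerInfty W κ K₀ E ε t) =
      towerSignedToSelmerInfty W κ K₀ E ε (conjTowerSignedSelmerInfty W κ K₀ E ε γ t) :=
  Subtype.ext rfl

/-- **The right half of (4.2), `Γ_K`-internally: the `Λ`-LINEAR SURJECTION `π : X(E/K_∞) ↠ X^ε(E/K_∞)`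
dual to `Sel^ε(E/K_∞) ⊆ Sel(E/K_∞)`, with kernel the annihilator of `Sel^ε`.** For a classical datum
`Dc` and a signed datum `D` at the same generator `γ ∈ Gal(K̄/K₀)` (`κ` onto on `Gal(K̄/K₀)`) there is a
`Λ`-linear `π : Dc.X → D.X` with `toDual (π x) = toDual_c x ∘ incl`, onto (characters of `Sel^ε` extend
to `Sel`: `ℚ/ℤ` is divisible), and `π x = 0 ↔ x` kills `Sel^ε` — x2's abstract
`X2.DualRestriction.exists_restrict_surjective` (both `Λ`-actions are the canonical ones, natural along
the intertwining inclusion). So `X^ε(E/K_∞) ≅ X(E/K_∞) ⧸ Sel^{ε,⊥}` as `Λ`-modules.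
[cite: KitajimaOtsuki2018, (4.2) (arXiv:1607.03612 p. 19)] [cite: GreenbergLNM1716, §1 (p. 60)] -/
theorem TowerSelmerDualData.exists_restrict
    (hK₀ : ∀ x : Multiplicative ℤ_[p], ∃ g ∈ galRange (K := K) K₀, κ g = x)
    {γ : Field.absoluteGaloisGroup K} (hγ : κ.IsTopGenerator γ) (hγ₀ : γ ∈ galRange (K := K) K₀)
    (Dc : TowerSelmerDualData W κ K₀ γ) (D : TowerSignedSelmerDualData W κ K₀ E γ ε) :
    ∃ π : Dc.X →ₗ[IwasawaAlgebra p] D.X, Function.Surjective π ∧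
      (∀ x, D.toDual (π x) = (Dc.toDual x).comp (towerSignedToSelmerInfty W κ K₀ E ε)) ∧
      ∀ x, π x = 0 ↔ ∀ (s : W.subgroupH1 p (towerTopSubgroup κ K₀))
        (hs : s ∈ towerSignedSelmerInfty W κ K₀ E ε),
        Dc.toDual x ⟨s, towerSignedSelmerInfty_le_towerSelmerInfty W κ K₀ E ε hs⟩ = 0 := by
  obtain ⟨π, hsurj, hπ, hker⟩ := X2.DualRestriction.exists_restrict_surjective
    (conjTowerSelmerInfty W κ K₀ γ) (conjTowerSignedSelmerInfty W κ K₀ E ε γ)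
    (isLocNil_conjTowerSelmerInfty_sub_one W κ K₀ hK₀ hγ hγ₀)
    (isLocNil_conjTowerSignedSelmerInfty_sub_one W κ K₀ E ε hK₀ hγ hγ₀)
    Dc.toDual D.toDual Dc.bijective D.bijective
    (fun x s ↦ by rw [Dc.toDual_T_smul]; rfl) Dc.toDual_C_smul
    (fun x s ↦ by rw [D.toDual_T_smul]; rfl) D.toDual_C_smul
    (towerSignedToSelmerInfty W κ K₀ E ε)
    (conjTowerSelmerInfty_towerSignedToSelmerInfty W κ K₀ E ε γ)
    (towerSignedToSelmerInfty_injective W κ K₀ E ε)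
  refine ⟨π, hsurj, hπ, fun x ↦ (hker x).trans ⟨fun h s hs ↦ ?_, fun h ↦ ?_⟩⟩
  · exact DFunLike.congr_fun h ⟨s, hs⟩
  · ext t
    exact h t.1 t.2

end Restrict

/-! ## §4 Kitajima–Otsuki Thm. 4.8 on the objects, reduced to Thm. 4.5 + [Gre99] 1.7 + Prop. 3.32 -/

section ThmFourEight

variable {K : Type} [Field K] [NumberField K] (W : WeierstrassCurve K) {p : ℕ} [Fact p.Prime]
  (κ : ZpExtension K p) (K₀ : Type) [Field K₀] [NumberField K₀] [Algebra K K₀]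
  [(galRange (K := K) K₀).Normal] (E : Type) [Field E] [Algebra K E] (ε : ℤˣ)

/-- **Kitajima–Otsuki Thm. 4.8 ON THE TREE'S OBJECTS, reduced in the kernel to its three inputs.** Let
`Dc` be a Pontryagin-dual datum of the classical `Sel(E/K_∞)` and `D` one of `Sel^ε(E/K_∞)` at the same
generator `γ ∈ Gal(K̄/K₀)` (`κ` onto on `Gal(K̄/K₀)`; `K : Type`). ASSUME, displayed: (h45) `X(E/K_∞)`
has no non-zero finite `Λ`-submodule [Thm. 4.5]; (hrank) `rank_Λ X(E/K_∞) ≥ r` [Gre99 Thm. 1.7: corank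
`≥ Σ_v [F_{0,v}:ℚ_p]`]; (hι) the annihilator of `Sel^ε(E/K_∞)` in `X(E/K_∞)` is the image of a
`Λ`-linear `ι : Λ^r → X(E/K_∞)` [the left half of (4.2): it is the image of
`⊕_v (H¹(F_{∞,v},E[p^∞])/E^ε ⊗ ℚ_p/ℤ_p)^∨`, which is `≅ Λ^r` by Prop. 3.32]; (htor) `X^ε(E/K_∞)` is
`Λ`-torsion [(vi)]. THEN `X^ε(E/K_∞)` has no non-zero finite `Λ`-submodule. Proof = §4.2 verbatim: `π`
of §3 has kernel `ι(Λ^r)`; Prop. 4.6 (`ι` injective by rank count) and Prop. 4.7 (Greenberg's lemma)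
are the tree's `Iwasawa.forall_finite_eq_bot_of_surjective_of_ker_eq_range_of_le_rank`. NOTHING of
the four inputs is asserted. [cite: KitajimaOtsuki2018, Thm. 4.8 with (4.2), Prop. 4.6, Prop. 4.7 (arXiv:1607.03612 p. 19)]
[cite: GreenbergLNM1716, Thm. 1.7 and pp. 104–105] -/
theorem TowerSignedSelmerDualData.forall_finite_eq_bot_of_towerSelmerDual
    (hK₀ : ∀ x : Multiplicative ℤ_[p], ∃ g ∈ galRange (K := K) K₀, κ g = x)
    {γ : Field.absoluteGaloisGroup K} (hγ : κ.IsTopGenerator γ) (hγ₀ : γ ∈ galRange (K := K) K₀)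
    (Dc : TowerSelmerDualData W κ K₀ γ) (D : TowerSignedSelmerDualData W κ K₀ E γ ε)
    (h45 : ∀ N : Submodule (IwasawaAlgebra p) Dc.X, Finite N → N = ⊥)
    {r : ℕ} (hrank : (r : Cardinal) ≤ Module.rank (IwasawaAlgebra p) Dc.X)
    (ι : (Fin r → IwasawaAlgebra p) →ₗ[IwasawaAlgebra p] Dc.X)
    (hι : ∀ x : Dc.X, x ∈ LinearMap.range ι ↔ ∀ (s : W.subgroupH1 p (towerTopSubgroup κ K₀))
        (hs : s ∈ towerSignedSelmerInfty W κ K₀ E ε),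
        Dc.toDual x ⟨s, towerSignedSelmerInfty_le_towerSelmerInfty W κ K₀ E ε hs⟩ = 0)
    (htor : Module.IsTorsion (IwasawaAlgebra p) D.X) :
    ∀ M : Submodule (IwasawaAlgebra p) D.X, Finite M → M = ⊥ := by
  obtain ⟨π, hsurj, -, hker⟩ :=
    TowerSelmerDualData.exists_restrict W κ K₀ E ε hK₀ hγ hγ₀ Dc D
  have hkr : LinearMap.ker π = LinearMap.range ι := by
    ext x
    rw [LinearMap.mem_ker, hker x, hι x]
  exact Iwasawa.forall_finite_eq_bot_of_surjective_of_ker_eq_range_of_le_rank p h45 hrank ι π hsurj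
    hkr htor

end ThmFourEight


end Summit.BirchSwinnertonDyer.Rank1Residual.Additive

end
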